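/-
Copyright (c) 2026 the pub-hodgecm-mathlib formalisation cell (harness21).  Prover seat hodgecm-mathlib-K2Liu-p11 (g0), Track B «K2-LIT»,
#184♮ = hLiu418 = `stmt-HodgeConjecture-24832`; LEAD F0P6-plan (g12) DEAL 2026-09-04T07:52:11Z «(α) ADELIC→ARCH GLUE», SIGS-RoadI-v3
§Hol rows H1-E ∕ Hol-2b, file G-1 (abstract frame layer).  THEOREMS ONLY (no `def`, no `instance`, no notation, no named-fact hypothesis,
no `sorry`).
-/
import Summits.HodgeConjecture.HodgeConjecture.Theorems.K2LiuHermitianTubeCRCartan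
import HarnessLib

/-!
# Crux `HLiu418`, Road I: holomorphic descent THROUGH A FRAME MAP (the glue between the group-side Lie data and the tube dictionary)

Cell `hodgecm-mathlib`, crux item hLiu418 = `stmt-HodgeConjecture-24832` (helper lane `--supports`, count-neutral).

`exists_holDescend_of_frame` — in the ABSTRACT FRAME currency of K2Liu-p10 (g2)'s Hol-2b sentence (`A` a topological group,
`Fr : A → ∏_σ M_{2n}(ℂ)` multiplicative, valued in and onto `∏_σ U(J)`, here also injective and topology-inducing; `F : X → A → ℂ` the
group-side form, `Φ` its tube-side avatar with the link `Φ x (Fr a) = F x a`): if `F x` has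
 (T)  the scalar `K∞`-type `F x (a u) = (∏_s det(denom (Fr u)_s (i·1))^{k_s})⁻¹ F x a` for `u` framed into `Stab(i·1)^σ`,
 (L)  derivatives `DF x s Y a` along the one-parameter subgroups `t ↦ a · E s Y t` framed to `update 1 s (exp (tY))` (`Y ∈ 𝔲(J)`),
      linear in `Y`, continuous in `a`,
 (CR) `DF x s (μ b) a = i · DF x s (σ b) a` (hermitian `b`; the tube `𝔭⁻` letters of ★ `K2LiuHermitianTubeFramePMinus`),
then there is `f : X → ∏_σ M_n(ℂ) → ℂ` with the (E0) dictionary and (E1) holomorphy on `ℌ_n^σ` in coordinates — EXACTLY the binders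
`hE0`, `hhol` of ★ `K2LiuHolTubeRigidity.eq_zero_of_hol_of_transl_invariant` ∕ p10's `eq_zero_of_hol_of_frame`.
Proof: per `x`, ★ H1-E `exists_holDescend_of_lieCR` applied to `Φ x` with `D s Y g := DF x s Y (Fr⁻¹ g)`; injectivity makes `D` well defined,
`IsInducing` carries continuity, multiplicativity carries (T) and (L).  The adelic instantiation (`A = U(hermD)(L ⊗ ℝ)`, `Fr` through
★ H1-C `exists_tubeFrame_arch₂`, (L) from G1's `archExp` orbits) is file G-2.
References: [Shimura1997, §§5–6]; [Bump1997, §2.1].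
HONEST LABEL: HC_CM is proved only modulo the 7 printed citations (2 remaining named inputs: hLiu418 = stmt-HodgeConjecture-24832,
h413 = stmt-HodgeConjecture-24833) until rung 0 closes; count-neutral helper, closes no socket.
-/

set_option autoImplicit false
set_option linter.dupNamespace false

noncomputable section

open scoped Matrix Topology
open Filter Set NormedSpace Complex Matrix
open Literature.NumberTheory.ModularForms.SiegelUpperHalfSpace (num denom moeb)
open Literature.AlgebraicGeometry.ShimuraVarieties.KudlaRapoport2013.Sec11Sec12MainTheorem (hermUpperHalfSpace)
open Summit.HodgeConjecture.HodgeConjecture.Cruxes.HLiu418.K2LiuHermitianTubeCRCartan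

namespace Summit.HodgeConjecture.HodgeConjecture.Cruxes.HLiu418.K2LiuHolDescendFrame

variable {σ : Type*} [Fintype σ] [DecidableEq σ] {n : ℕ} {A : Type*} [Group A] [TopologicalSpace A] {X : Type*}

/-- **HOLOMORPHIC DESCENT THROUGH A FRAME MAP.**  See the module docstring: the group-side data (T) (L) (CR) on `F x`, transported by a
multiplicative, injective, topology-inducing frame map `Fr : A → ∏_σ U(J)` (onto), yield the descended `f` with the (E0) dictionary and
(E1) holomorphy on `ℌ_n^σ` — the `hE0`/`hhol` binders of ★ `eq_zero_of_hol_of_transl_invariant`. [cite: Shimura1997, §§5–6] -/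
theorem exists_holDescend_of_frame (k : σ → ℤ) (Fr : A → σ → Matrix (Fin n ⊕ Fin n) (Fin n ⊕ Fin n) ℂ)
    (hmul : ∀ a b s, Fr (a * b) s = Fr a s * Fr b s)
    (hmem : ∀ a s, (Fr a s)ᴴ * Matrix.J (Fin n) ℂ * Fr a s = Matrix.J (Fin n) ℂ)
    (hsurj : ∀ g : σ → Matrix (Fin n ⊕ Fin n) (Fin n ⊕ Fin n) ℂ, (∀ s, (g s)ᴴ * Matrix.J (Fin n) ℂ * g s = Matrix.J (Fin n) ℂ) →
      ∃ a, Fr a = g)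
    (hinj : Function.Injective Fr) (hind : Topology.IsInducing Fr)
    (F : X → A → ℂ) (Φ : X → (σ → Matrix (Fin n ⊕ Fin n) (Fin n ⊕ Fin n) ℂ) → ℂ) (hΦ : ∀ x a, Φ x (Fr a) = F x a)
    (hT : ∀ x a u, (∀ s, moeb (Fr u s) (I • 1) = I • 1) →
      F x (a * u) = (∏ s, (denom (Fr u s) (I • (1 : Matrix (Fin n) (Fin n) ℂ))).det ^ k s)⁻¹ * F x a)
    (E : σ → Matrix (Fin n ⊕ Fin n) (Fin n ⊕ Fin n) ℂ → ℝ → A)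
    (hE : ∀ (s : σ) (Y : Matrix (Fin n ⊕ Fin n) (Fin n ⊕ Fin n) ℂ) (t : ℝ), Yᴴ * Matrix.J (Fin n) ℂ + Matrix.J (Fin n) ℂ * Y = 0 →
      Fr (E s Y t) = Function.update (1 : σ → Matrix (Fin n ⊕ Fin n) (Fin n ⊕ Fin n) ℂ) s (exp (t • Y)))
    (DF : X → σ → Matrix (Fin n ⊕ Fin n) (Fin n ⊕ Fin n) ℂ → A → ℂ)
    (hDF : ∀ x s Y a, Yᴴ * Matrix.J (Fin n) ℂ + Matrix.J (Fin n) ℂ * Y = 0 →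
      HasDerivAt (fun t : ℝ => F x (a * E s Y t)) (DF x s Y a) 0)
    (hDFl : ∀ x s a (c : ℝ) (Y Y' : Matrix (Fin n ⊕ Fin n) (Fin n ⊕ Fin n) ℂ),
      Yᴴ * Matrix.J (Fin n) ℂ + Matrix.J (Fin n) ℂ * Y = 0 → Y'ᴴ * Matrix.J (Fin n) ℂ + Matrix.J (Fin n) ℂ * Y' = 0 →
      DF x s (c • Y + Y') a = (c : ℂ) * DF x s Y a + DF x s Y' a)
    (hDFc : ∀ x s Y, Yᴴ * Matrix.J (Fin n) ℂ + Matrix.J (Fin n) ℂ * Y = 0 → Continuous (DF x s Y))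
    (hCR : ∀ x s (b : Matrix (Fin n) (Fin n) ℂ) a, bᴴ = b →
      DF x s (fromBlocks b 0 0 (-b)) a = I * DF x s (fromBlocks 0 b b 0) a) :
    ∃ f : X → (σ → Matrix (Fin n) (Fin n) ℂ) → ℂ,
      (∀ x (g : σ → Matrix (Fin n ⊕ Fin n) (Fin n ⊕ Fin n) ℂ), (∀ s, (g s)ᴴ * Matrix.J (Fin n) ℂ * g s = Matrix.J (Fin n) ℂ) →
        f x (fun s => moeb (g s) (I • 1)) = (∏ s, (denom (g s) (I • (1 : Matrix (Fin n) (Fin n) ℂ))).det ^ k s) * Φ x g) ∧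
      ∀ x, DifferentiableOn ℂ (fun z : σ → Fin n → Fin n → ℂ => f x fun s => Matrix.of (z s))
        {z | ∀ s, Matrix.of (z s) ∈ hermUpperHalfSpace n} := by
  classical
  -- `∏_σ U(J)` is the range of the frame map
  have hS : {g : σ → Matrix (Fin n ⊕ Fin n) (Fin n ⊕ Fin n) ℂ | ∀ s, (g s)ᴴ * Matrix.J (Fin n) ℂ * g s = Matrix.J (Fin n) ℂ} =
      Set.range Fr := by
    ext g
    constructor
    · intro hg; obtain ⟨a, rfl⟩ := hsurj g hg; exact ⟨a, rfl⟩
    · rintro ⟨a, rfl⟩; exact hmem a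
  have key : ∀ x, ∃ fx : (σ → Matrix (Fin n) (Fin n) ℂ) → ℂ,
      (∀ g : σ → Matrix (Fin n ⊕ Fin n) (Fin n ⊕ Fin n) ℂ, (∀ s, (g s)ᴴ * Matrix.J (Fin n) ℂ * g s = Matrix.J (Fin n) ℂ) →
        fx (fun s => moeb (g s) (I • 1)) = (∏ s, (denom (g s) (I • (1 : Matrix (Fin n) (Fin n) ℂ))).det ^ k s) * Φ x g) ∧
      DifferentiableOn ℂ (fun z : σ → Fin n → Fin n → ℂ => fx fun s => Matrix.of (z s))
        {z | ∀ s, Matrix.of (z s) ∈ hermUpperHalfSpace n} := by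
    intro x
    -- the Lie derivatives transported through `Fr⁻¹`
    obtain ⟨D, hD⟩ : ∃ D : σ → Matrix (Fin n ⊕ Fin n) (Fin n ⊕ Fin n) ℂ → (σ → Matrix (Fin n ⊕ Fin n) (Fin n ⊕ Fin n) ℂ) → ℂ,
        ∀ s Y g, D s Y g = if h : ∃ a, Fr a = g then DF x s Y h.choose else 0 := ⟨_, fun _ _ _ => rfl⟩
    have hD_Fr : ∀ s Y a, D s Y (Fr a) = DF x s Y a := by
      intro s Y a
      have h : ∃ a', Fr a' = Fr a := ⟨a, rfl⟩
      rw [hD, dif_pos h, hinj h.choose_spec]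
    refine exists_holDescend_of_lieCR k (Φ x) ?_ D ?_ ?_ ?_ ?_
    · -- (T)
      intro g u hg hu huI
      obtain ⟨a, rfl⟩ := hsurj g hg
      obtain ⟨u', rfl⟩ := hsurj u hu
      have hprod : Fr a * Fr u' = Fr (a * u') := by funext s; rw [Pi.mul_apply, hmul]
      rw [hprod, hΦ, hΦ, hT x a u' huI]
    · -- (L)
      intro s Y g hY hg
      obtain ⟨a, rfl⟩ := hsurj g hg
      have hupd : ∀ t : ℝ, Function.update (Fr a) s (Fr a s * exp (t • Y)) = Fr (a * E s Y t) := by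
        intro t
        funext s'
        by_cases hs' : s' = s
        · subst hs'
          rw [Function.update_self, hmul, hE s' Y t hY, Function.update_self]
        · rw [Function.update_of_ne hs', hmul, hE s Y t hY, Function.update_of_ne hs', Pi.one_apply, Matrix.mul_one]
      simp_rw [hupd, hΦ]
      rw [hD_Fr]
      exact hDF x s Y a hY
    · -- (L-lin)
      intro s g c Y Y' hY hY' hg
      obtain ⟨a, rfl⟩ := hsurj g hg
      rw [hD_Fr, hD_Fr, hD_Fr]
      exact hDFl x s a c Y Y' hY hY'
    · -- (hDc): continuity on `∏ U(J) = range Fr`, through the inducing map `Fr`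
      intro s Y hY g hg
      obtain ⟨a, rfl⟩ := hsurj g hg
      show Tendsto (D s Y) (𝓝[{g | ∀ s, (g s)ᴴ * Matrix.J (Fin n) ℂ * g s = Matrix.J (Fin n) ℂ}] (Fr a)) (𝓝 (D s Y (Fr a)))
      rw [hS, ← hind.map_nhds_eq, Filter.tendsto_map'_iff, hD_Fr]
      have hc : (D s Y) ∘ Fr = DF x s Y := funext fun a' => hD_Fr s Y a'
      rw [hc]
      exact (hDFc x s Y hY).continuousAt
    · -- (CR)
      intro s b g hb hg
      obtain ⟨a, rfl⟩ := hsurj g hg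
      rw [hD_Fr, hD_Fr]
      exact hCR x s b a hb
  choose f hf₁ hf₂ using key
  exact ⟨f, hf₁, hf₂⟩

end Summit.HodgeConjecture.HodgeConjecture.Cruxes.HLiu418.K2LiuHolDescendFrame

end
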